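import Mathlib
import Summits.PneNP.PneNP.Theses.OverlapGapAlgebra
import Summits.PneNP.PneNP.Theorems.OverlapGapAlgebraSolvableImpliesStableSectionMeanSquareTransfer

/-!
# Strategist sketch — census signatures for crux stmt-PneNP-2463 (`SolvableImpliesStableSection`)

planner-cstrat-stmt-PneNP-2463-p1-0, 2026-08-17.  Typed artefacts for STRATEGY-CENSUS.md:

* `Core` — child T of the regime split (the crux verbatim on the core), = `RegimeSplit.stub_core`.
* `StableSolvabilityTransfer` — the STRENGTHEN lens S⁺: the thesis "instability needs algebra" in its
  sharpest path-free, (η,ν)-free form on the core: polynomial-time solvable with probability ≥ ε i.o. ⇒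
  solvable with probability ≥ ε′ i.o. by SOME map of mean-square single-literal-resample sensitivity
  s₂(n) with s₂ log³ n = o(n) (the exact hypothesis shape of the landed ℓ²-transfer
  `sissMS_concl_of_meanSquareStableSolver`, p120141).
* `core_of_stableSolvabilityTransfer : StableSolvabilityTransfer → Core` — S⁺ feeds the split (hence the
  crux, hence `closes`) by the landed transfer; kernel-checked below.
Why S⁺ buys nothing on the window: there `shwMSU_successCount_le` (InstabilityNecessary.lean, from the
proved item 2462) bounds the success of every map with s₂ log³ n ≤ δ n by C(1 + s₂ log² n)/n → 0, so
S⁺ restricted to α_k = 5·2^k log k/k is again `¬PolySolvable(k, α_k)` (census §Strengthen).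
-/

set_option linter.dupNamespace false

namespace Summit.PneNP.PneNP.Cruxes.SolvableImpliesStableSection.Strategist

open Finset Filter Asymptotics
open scoped Classical

/-- Child T of the regime split: the crux verbatim on the core. -/
def Core : Prop :=
  ∀ k : ℕ, 3 ≤ k → ∀ α η ν : ℝ, 2 ^ k * Real.log k / k ≤ α → α < 2 ^ k * Real.log 2 → 0 < η → η < 1 → 0 < ν → ν ≤ (1 / 2 : ℝ) ^ k → (∃ f : List Bool → List Bool, Literature.Computability.Complexity.IsPolyTime f ∧ ∃ ε : ℝ, 0 < ε ∧ ∃ᶠ n : ℕ in Filter.atTop, ∀ m : ℕ, m = ⌊α * n⌋₊ → ε ≤ ((Finset.univ.filter fun Φ : Fin m → Fin k → Fin n × Bool => ∀ i, ∃ j, (f (Literature.Computability.Complexity.encodingCNF.encode (List.ofFn fun a => List.ofFn fun b => (((Φ a b).1 : ℕ), (Φ a b).2)))).getD (Φ i j).1 false = (Φ i j).2).card : ℝ) / Fintype.card (Fin m → Fin k → Fin n × Bool)) → ∀ c : ℝ, 0 < c → ∃ᶠ n : ℕ in Filter.atTop, ∀ m : ℕ, m = ⌊α * n⌋₊ → ∃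 g : (Fin m → Fin k → Fin n × Bool) → (Fin n → Bool), Real.exp (-(c * n)) * Fintype.card (Fin (k + 1) → Fin m → Fin k → Fin n × Bool) ≤ ((Finset.univ.filter fun Ψ : Fin (k + 1) → Fin m → Fin k → Fin n × Bool => let P : Fin k → ℕ → Fin m → Fin k → Fin n × Bool := fun r q a b => if (a : ℕ) * k + b < q then Ψ r.succ a b else Ψ r.castSucc a b; (∀ r : Fin k, ∀ q ≤ m * k, ((Finset.univ.filter fun i : Fin m => ∀ j, g (P r q) (P r q i j).1 ≠ (P r q i j).2).card : ℝ) ≤ ν * m) ∧ ∀ r : Fin k, ∀ q < m * k, (hammingDist (g (P r q)) (g (P r (q + 1))) : ℝ) ≤ η * n).card : ℝ)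

/-- **S⁺ (strengthen lens): stable solvability transfer on the core.** -/
def StableSolvabilityTransfer : Prop :=
  ∀ k : ℕ, 3 ≤ k → ∀ α : ℝ, 2 ^ k * Real.log k / k ≤ α → α < 2 ^ k * Real.log 2 →
    (∃ f : List Bool → List Bool, Literature.Computability.Complexity.IsPolyTime f ∧
      ∃ ε : ℝ, 0 < ε ∧ ∃ᶠ n : ℕ in Filter.atTop, ∀ m : ℕ, m = ⌊α * n⌋₊ → ε ≤
        ((Finset.univ.filter fun Φ : Fin m → Fin k → Fin n × Bool => ∀ i, ∃ j,
          (f (Literature.Computability.Complexity.encodingCNF.encode (List.ofFn fun a =>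
            List.ofFn fun b => (((Φ a b).1 : ℕ), (Φ a b).2)))).getD (Φ i j).1 false =
              (Φ i j).2).card : ℝ) / Fintype.card (Fin m → Fin k → Fin n × Bool)) →
    ∃ s₂ : ℕ → ℝ, ((fun n : ℕ => s₂ n * Real.log n ^ 3) =o[atTop] (fun n : ℕ => (n : ℝ))) ∧
    ∃ ε : ℝ, 0 < ε ∧ ∃ᶠ n : ℕ in atTop, ∀ m : ℕ, m = ⌊α * n⌋₊ →
      ∃ g : (Fin m → Fin k → Fin n × Bool) → (Fin n → Bool),
        (∑ a : Fin m, ∑ b : Fin k, ∑ p : (Fin m → Fin k → Fin n × Bool) × (Fin n × Bool),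
          (hammingDist (g p.1) (g (Function.update p.1 a (Function.update (p.1 a) b p.2))) : ℝ) ^ 2)
          ≤ s₂ n * (((m * k : ℕ) : ℝ) * (Fintype.card (Fin m → Fin k → Fin n × Bool) * (2 * n))) ∧
        ε * Fintype.card (Fin m → Fin k → Fin n × Bool) ≤
          ((Finset.univ.filter fun Φ : Fin m → Fin k → Fin n × Bool =>
            ∀ i, ∃ j, g Φ (Φ i j).1 = (Φ i j).2).card : ℝ)

/-- **S⁺ ⇒ child T** by the landed ℓ²-transfer `sissMS_concl_of_meanSquareStableSolver`. -/
theorem core_of_stableSolvabilityTransfer (hS : StableSolvabilityTransfer) : Core := by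
  intro k hk α η ν hlo hhi hη _hη1 hν _hν1 hsolv c hc
  have hk1 : 1 ≤ k := by omega
  have hα : 0 < α := by
    have hk3 : (3 : ℝ) ≤ k := by exact_mod_cast hk
    have hlogk : 0 < Real.log k := Real.log_pos (by linarith)
    have : (0 : ℝ) < 2 ^ k * Real.log k / k := by positivity
    linarith
  obtain ⟨s₂, hs, ε, hε, hst⟩ := hS k hk α hlo hhi hsolv
  exact Summit.PneNP.PneNP.Theorems.sissMS_concl_of_meanSquareStableSolver k hk1 α η ν hα hη hν s₂ hs ε hε
    hst c hc

/-! ## Idea `pinned-ground-state-section` (lens: strengthen) — first lemmas as signatures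

The randomly pinned energy of an instance `Φ : Fin m → Fin k → Fin n × Bool` at `σ : Fin n → Bool` with weights
`w : Fin n → ℝ` and reference `σ₀ ≡ false`:  `F Φ σ = #violated(Φ, σ) + ∑ i, w i * (if σ i then 1 else 0)`. -/

/-- the pinned energy -/
def pinnedEnergy {m k n : ℕ} (w : Fin n → ℝ) (Φ : Fin m → Fin k → Fin n × Bool) (σ : Fin n → Bool) : ℝ :=
  (((Finset.univ : Finset (Fin m)).filter fun i => ∀ j, σ (Φ i j).1 ≠ (Φ i j).2).card : ℝ) +
    ∑ v : Fin n, (if σ v then w v else 0)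

/-- **First lemma 1 (validity is free).** For any selection `g` of pinned minimisers with weights in `[λ, 2λ]`:
if at least `ε·#Inst` instances are satisfiable then the MEAN number of clauses violated by `g` is at most
`√(m/(2ε)) + 2λn` (maxsat is 1-Lipschitz in the clauses: Efron–Stein + Chebyshev; then `F(gΦ) ≤ F(σ_opt)`). -/
def PinnedValidityFromSat : Prop :=
  ∀ (k m n : ℕ) (ε lam : ℝ), 0 < ε → 0 < lam → ∀ w : Fin n → ℝ, (∀ v, lam ≤ w v ∧ w v ≤ 2 * lam) →
    ∀ g : (Fin m → Fin k → Fin n × Bool) → (Fin n → Bool),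
      (∀ (Φ : Fin m → Fin k → Fin n × Bool) (σ : Fin n → Bool), pinnedEnergy w Φ (g Φ) ≤ pinnedEnergy w Φ σ) →
      ε * Fintype.card (Fin m → Fin k → Fin n × Bool) ≤
        ((Finset.univ.filter fun Φ : Fin m → Fin k → Fin n × Bool =>
          ∃ σ : Fin n → Bool, ∀ i, ∃ j, σ (Φ i j).1 = (Φ i j).2).card : ℝ) →
      (∑ Φ : Fin m → Fin k → Fin n × Bool,
          ((((Finset.univ : Finset (Fin m)).filter fun i => ∀ j, g Φ (Φ i j).1 ≠ (Φ i j).2).card : ℝ)))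
        ≤ (Real.sqrt (m / (2 * ε)) + 2 * lam * n) * Fintype.card (Fin m → Fin k → Fin n × Bool)

/-- **First lemma 2 (stability reduces to the landscape).** One resampled literal changes the pinned energy by at
most `1` pointwise, so the new minimiser is a `2`-near-minimiser of the old energy (deterministic). -/
def PinnedNearMinimiser : Prop :=
  ∀ (k m n : ℕ) (w : Fin n → ℝ) (g : (Fin m → Fin k → Fin n × Bool) → (Fin n → Bool)),
    (∀ (Φ : Fin m → Fin k → Fin n × Bool) (σ : Fin n → Bool), pinnedEnergy w Φ (g Φ) ≤ pinnedEnergy w Φ σ) →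
    ∀ (Φ : Fin m → Fin k → Fin n × Bool) (a : Fin m) (b : Fin k) (ℓ : Fin n × Bool),
      pinnedEnergy w Φ (g (Function.update Φ a (Function.update (Φ a) b ℓ))) ≤ pinnedEnergy w Φ (g Φ) + 2

/-- **The stub of the line (landscape non-degeneracy, child-G range).** For `k ≥ 3`, `0 < α < 2^k/k`, `η > 0` and
`λ > 0`: for SOME weight vector in `[λ, 2λ]^n` and some minimiser selection, the `2`-near-minimiser set has Hamming
diameter `≤ ηn` on all but an `A/n²` fraction of instances, eventually in `n`. -/
def PinnedDiameter : Prop :=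
  ∀ k : ℕ, 3 ≤ k → ∀ α η lam : ℝ, 0 < α → α < 2 ^ k / k → 0 < η → 0 < lam → ∃ A : ℝ, 0 < A ∧
    ∀ᶠ n : ℕ in Filter.atTop, ∀ m : ℕ, m = ⌊α * n⌋₊ →
      ∃ w : Fin n → ℝ, (∀ v, lam ≤ w v ∧ w v ≤ 2 * lam) ∧
      ∃ g : (Fin m → Fin k → Fin n × Bool) → (Fin n → Bool),
        (∀ (Φ : Fin m → Fin k → Fin n × Bool) (σ : Fin n → Bool), pinnedEnergy w Φ (g Φ) ≤ pinnedEnergy w Φ σ) ∧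
        (((Finset.univ.filter fun Φ : Fin m → Fin k → Fin n × Bool =>
            ∃ σ : Fin n → Bool, pinnedEnergy w Φ σ ≤ pinnedEnergy w Φ (g Φ) + 2 ∧
              η * n < hammingDist (g Φ) σ).card : ℝ) * (n : ℝ) ^ 2
          ≤ A * Fintype.card (Fin m → Fin k → Fin n × Bool))

/-- sanity: lemma 2 is provable now (the energy is `1`-Lipschitz in one literal). -/
theorem pinnedNearMinimiser_holds : PinnedNearMinimiser := by
  intro k m n w g hg Φ a b ℓ
  set Φ' := Function.update Φ a (Function.update (Φ a) b ℓ) with hΦ'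
  -- pointwise: |F_Φ σ - F_Φ' σ| ≤ 1 for every σ
  have key : ∀ σ : Fin n → Bool, |pinnedEnergy w Φ σ - pinnedEnergy w Φ' σ| ≤ 1 := by
    intro σ
    unfold pinnedEnergy
    have hsub : ∀ (P Q : Fin m → Prop) [DecidablePred P] [DecidablePred Q],
        (∀ i, i ≠ a → (P i ↔ Q i)) →
        |(((Finset.univ : Finset (Fin m)).filter P).card : ℝ) - (((Finset.univ : Finset (Fin m)).filter Q).card : ℝ)| ≤ 1 := by
      intro P Q _ _ hPQ
      have h1 : ((Finset.univ : Finset (Fin m)).filter P) ⊆ insert a ((Finset.univ : Finset (Fin m)).filter Q) := by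
        intro i hi
        rw [Finset.mem_insert]
        by_cases hia : i = a
        · exact Or.inl hia
        · right
          simp only [Finset.mem_filter, Finset.mem_univ, true_and] at hi ⊢
          exact (hPQ i hia).1 hi
      have h2 : ((Finset.univ : Finset (Fin m)).filter Q) ⊆ insert a ((Finset.univ : Finset (Fin m)).filter P) := by
        intro i hi
        rw [Finset.mem_insert]
        by_cases hia : i = a
        · exact Or.inl hia
        · right
          simp only [Finset.mem_filter, Finset.mem_univ, true_and] at hi ⊢
          exact (hPQ i hia).2 hi
      have c1 := (Finset.card_le_card h1).trans (Finset.card_insert_le _ _)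
      have c2 := (Finset.card_le_card h2).trans (Finset.card_insert_le _ _)
      rw [abs_le]
      constructor
      · have : (((Finset.univ : Finset (Fin m)).filter Q).card : ℝ) ≤ ((Finset.univ : Finset (Fin m)).filter P).card + 1 := by
          exact_mod_cast c2
        linarith
      · have : (((Finset.univ : Finset (Fin m)).filter P).card : ℝ) ≤ ((Finset.univ : Finset (Fin m)).filter Q).card + 1 := by
          exact_mod_cast c1
        linarith
    have := hsub (fun i => ∀ j, σ (Φ i j).1 ≠ (Φ i j).2) (fun i => ∀ j, σ (Φ' i j).1 ≠ (Φ' i j).2) (by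
      intro i hia
      have : Φ' i = Φ i := by rw [hΦ']; exact Function.update_of_ne hia _ _
      simp [this])
    simpa [add_sub_add_right_eq_sub] using this
  have h1 := key (g Φ')      -- F_Φ (gΦ') ≤ F_Φ' (gΦ') + 1
  have h2 := key (g Φ)       -- F_Φ' (gΦ) ≤ F_Φ (gΦ) + 1
  have h3 := hg Φ' (g Φ)     -- F_Φ' (gΦ') ≤ F_Φ' (gΦ)
  rw [abs_le] at h1 h2
  linarith [h1.1, h1.2, h2.1, h2.2, h3]

end Summit.PneNP.PneNP.Cruxes.SolvableImpliesStableSection.Strategist
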